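import Summits.FinalStateConjecture.FinalStateConjecture.Theorems.ZeroEnergyKerrOrBombOneLockedExplosionDefs
import Summits.FinalStateConjecture.FinalStateConjecture.Theorems.ZeroEnergyKerrOrBombStationaryLimitReductionIsometryTransport
import Literature.Geometry.Lorentzian.MGHDUniqueness
import HarnessLib

/-!
# Route ZeroEnergyKerrOrBomb · crux `StationaryLimitReduction` (stmt-FinalStateConjecture-10021), line
# `one-locked-explosion` — ONE MAXIMAL DEVELOPMENT SERVES ALL, and the reduction of stub
# `stub_kerrLimitsAreGood` to its single-development core

Helper file (`--supports stmt-FinalStateConjecture-10021`; registered helper `summitProperty_of_oneMaximal`)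
from the lead's wave-1 stub-worker for `stub_kerrLimitsAreGood` (lead prover-line-stmt-FinalStateConjecture-10021-0,
2026-08-16). The summit property `SummitProperty X D` (Defs module) quantifies over ALL maximal vacuum Cauchy
developments of `D`, while every settling / explosion / capture statement of the line informs about ONE of them.
The passage is the tree's Choquet-Bruhat–Geroch uniqueness `VacuumCauchyDevelopment.isIsometricTo_of_isMaximal'`
(`MGHDUniqueness.lean`, axioms standard) plus the transport kit of
`ZeroEnergyKerrOrBombStationaryLimitReductionIsometryTransport.lean`:

* `image_exteriorOf`: `ψ '' exteriorOf 𝒟₁ U = exteriorOf 𝒟₂ (ψ '' U)` for an isometry of developments;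
* **`summitProperty_of_isMaximal`** (binder-free form `summitProperty_of_oneMaximal`): complete `𝓘⁺` of all
  MGHDs + ONE maximal `𝒟` with a `C²` exhaustive sub-extremal decomposition of `exteriorOf 𝒟 d.charted` ⇒
  `SummitProperty X D` — the lemma stubs 3, 6 and 7 of the line all need (it also settles the deep-refuter's
  gen-0 remark "hidden shared lemma MGHDRigidity": the rigidity is PROVED in the tree);
* `kerrLimitsAreGood_of_oneDevelopment`: the registered statement of `stub_kerrLimitsAreGood` follows from its
  SINGLE-DEVELOPMENT core ("`C¹` Kerr settling of one MGHD ⇒ `C²` exhaustive Kerr decomposition of its own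
  exterior, or local escape" — NOT a tree fact and not asserted; the theorem only certifies the reduction).

No named fact; nothing restated. References: Choquet-Bruhat–Geroch, CMP 14 (1969) Thm. 3; Ringström 2009,
Thm. 16.6; Dafermos–Luk arXiv:1710.01722 §1.2.1.
-/

set_option linter.dupNamespace false

noncomputable section

open scoped Manifold ContDiff Topology ENNReal
open Set Filter Bundle

namespace Summit.FinalStateConjecture.FinalStateConjecture.Theorems.OneLockedExplosion

open Literature.Geometry.Lorentzian

/-! ## §T2 One maximal development serves all (MGHD uniqueness + transport) -/

section DevelopmentTransport

variable {X : Type} [TopologicalSpace X] [ChartedSpace E3 X] [IsManifold (𝓡 3) ∞ X]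
  [ConnectedSpace X] {D : InitialDataSet (𝓡 3) X}

/-- **The self-determined exterior is transported**: for an isometry of developments `ψ`
(`ψ ∘ ι₁ = ι₂`), `ψ(J⁺(ι₁ X) ∩ I⁻(U)) = J⁺(ι₂ X) ∩ I⁻(ψ(U))`. [folklore] -/
theorem image_exteriorOf {𝒟₁ 𝒟₂ : CauchyDevelopment D}
    (ψ : Diffeomorph (𝓡 4) (𝓡 4) 𝒟₁.carrier 𝒟₂.carrier ∞)
    (hiso : ∀ y, pullbackBilin (I := 𝓡 4) (I' := 𝓡 4) ψ 𝒟₂.metric.val y = 𝒟₁.metric.val y)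
    (hτ : 𝒟₁.timeOrientation.PreservesTimeOrientation ψ 𝒟₂.timeOrientation)
    (hι : ψ ∘ 𝒟₁.embed = 𝒟₂.embed) (U : Set 𝒟₁.carrier) :
    ψ '' Summit.FinalStateConjecture.exteriorOf 𝒟₁ U =
      Summit.FinalStateConjecture.exteriorOf 𝒟₂ (ψ '' U) := by
  have hinj : Function.Injective ψ := ψ.injective
  unfold Summit.FinalStateConjecture.exteriorOf
  rw [Set.image_inter hinj, image_causalFuture_eq (𝓢₁ := 𝒟₁.toSpacetime)
      (𝓢₂ := 𝒟₂.toSpacetime) ψ hiso hτ, image_chronologicalPast_eq (𝓢₁ := 𝒟₁.toSpacetime)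
      (𝓢₂ := 𝒟₂.toSpacetime) ψ hiso hτ, ← Set.range_comp, hι]

variable (X)

/-- **One maximal development serves all.** If every MGHD of `D` has complete `𝓘⁺` and ONE
maximal vacuum Cauchy development `𝒟` of `D` carries an exhaustive sub-extremal `N`-Kerr final
state decomposition in `C²` of its self-determined exterior, then `D` has the summit property:
any other MGHD `𝒟'` is isometric to `𝒟` as a development (Choquet-Bruhat–Geroch uniqueness,
`VacuumCauchyDevelopment.isIsometricTo_of_isMaximal'`, proved in the tree), and the decomposition,
its charted region, the exterior `J⁺(ι X) ∩ I⁻(charted)` and exhaustiveness are transported along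
the isometry (`transportDecomposition`, `image_exteriorOf`,
`hasExhaustiveCharts_transportDecomposition`). [folklore] -/
theorem summitProperty_of_isMaximal {D : InitialDataSet (𝓡 3) X}
    (hI : ∀ 𝒟 : VacuumCauchyDevelopment D, 𝒟.IsMaximal →
      Summit.FinalStateConjecture.HasCompleteNullInfinity 𝒟.toCauchyDevelopment)
    (𝒟 : VacuumCauchyDevelopment D) (hmax : 𝒟.IsMaximal) (O : Set 𝒟.carrier)
    (d : FinalStateDecomposition 𝒟.toSpacetime O 2)
    (hsub : ∀ i, Kerr.IsSubextremal (d.mass i) (d.spin i))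
    (hO : O = Summit.FinalStateConjecture.exteriorOf 𝒟.toCauchyDevelopment d.charted)
    (hex : Summit.FinalStateConjecture.HasExhaustiveCharts d) :
    SummitProperty X D := by
  refine ⟨⟨𝒟, hmax⟩, fun 𝒟' hmax' ↦ ⟨hI 𝒟' hmax', ?_⟩⟩
  obtain ⟨ψ, hiso, hτ, hι⟩ := VacuumCauchyDevelopment.isIsometricTo_of_isMaximal' hmax hmax'
  refine ⟨ψ '' O, transportDecomposition (𝓢₁ := 𝒟.toSpacetime) (𝓢₂ := 𝒟'.toSpacetime) ψ hiso hτ d,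
    hsub, ?_, hasExhaustiveCharts_transportDecomposition _ hiso hτ d hex⟩
  rw [charted_transportDecomposition, ← image_exteriorOf ψ hiso hτ hι, ← hO]

end DevelopmentTransport

/-! ## §R What is left of the stub once "one MGHD serves all" is discharged

The registered signature follows by `summitProperty_of_isMaximal` from the SINGLE-DEVELOPMENT
statement below (hypothesis `upgrade`): for the one maximal development handed over, `C¹` Kerr
settling (`SettlesTo` + `IsKerrExterior` holes) yields a `C²` exhaustive sub-extremal Kerr
decomposition of ITS OWN exterior, or the datum escapes. This hypothesis is the whole remaining
content (chart transfer + `C¹ → C²` upgrade + far-field cleaning); it is NOT a tree fact and is not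
asserted here — the theorem only certifies the reduction. -/

section Reduction

/-- **Reduction of `stub_kerrLimitsAreGood` to its single-development core.** If, for every
admissible datum and every maximal development settling in `C¹` to Kerr holes, either THAT
development carries a `C²` exhaustive sub-extremal Kerr decomposition of its self-determined
exterior or the datum escapes locally, then the registered statement of stub 3 holds (the passage
to all MGHDs is `summitProperty_of_isMaximal`). Pure logic over the tree's MGHD uniqueness.
[folklore] -/
theorem kerrLimitsAreGood_of_oneDevelopment
    (upgrade : ∀ (X : Type) [TopologicalSpace X] [ChartedSpace E3 X] [IsManifold (𝓡 3) ∞ X]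
      [T2Space X] [SecondCountableTopology X] [ConnectedSpace X],
      ∀ D ∈ admissibleVacuumData X, ∀ 𝒟 : VacuumCauchyDevelopment D, 𝒟.IsMaximal →
        ∀ (O : Set 𝒟.carrier) (sd : StationaryFinalStateDecomposition 𝒟.toSpacetime O 1),
          SettlesTo 𝒟 sd → (∀ i, IsKerrExterior (sd.hole i)) →
            (∃ (O' : Set 𝒟.carrier) (d : FinalStateDecomposition 𝒟.toSpacetime O' 2),
              (∀ i, Kerr.IsSubextremal (d.mass i) (d.spin i)) ∧
                O' = Summit.FinalStateConjecture.exteriorOf 𝒟.toCauchyDevelopment d.charted ∧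
                  Summit.FinalStateConjecture.HasExhaustiveCharts d) ∨
              HasLocalEscape (admissibleVacuumData X) (SummitProperty X) D) :
    ∀ (X : Type) [TopologicalSpace X] [ChartedSpace E3 X] [IsManifold (𝓡 3) ∞ X] [T2Space X]
      [SecondCountableTopology X] [ConnectedSpace X],
      ∀ D ∈ admissibleVacuumData X,
        (∀ 𝒟 : VacuumCauchyDevelopment D, 𝒟.IsMaximal →
          Summit.FinalStateConjecture.HasCompleteNullInfinity 𝒟.toCauchyDevelopment) →
        ∀ 𝒟 : VacuumCauchyDevelopment D, 𝒟.IsMaximal →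
          ∀ (O : Set 𝒟.carrier) (sd : StationaryFinalStateDecomposition 𝒟.toSpacetime O 1),
            SettlesTo 𝒟 sd → (∀ i, IsKerrExterior (sd.hole i)) →
              SummitProperty X D ∨ HasLocalEscape (admissibleVacuumData X) (SummitProperty X) D := by
  intro X _ _ _ _ _ _ D hD hI 𝒟 hmax O sd hset hK
  rcases upgrade X D hD 𝒟 hmax O sd hset hK with ⟨O', d, hsub, hO', hex⟩ | hesc
  · exact Or.inl (summitProperty_of_isMaximal X hI 𝒟 hmax O' d hsub hO' hex)
  · exact Or.inr hesc

end Reduction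

/-- **One maximal development serves all** (binder-free form of `summitProperty_of_isMaximal`, the
registered helper of this file). [folklore] -/
theorem summitProperty_of_oneMaximal :
    ∀ (X : Type) [TopologicalSpace X] [ChartedSpace E3 X] [IsManifold (𝓡 3) ∞ X] [ConnectedSpace X]
      (D : InitialDataSet (𝓡 3) X),
      (∀ 𝒟 : VacuumCauchyDevelopment D, 𝒟.IsMaximal →
        Summit.FinalStateConjecture.HasCompleteNullInfinity 𝒟.toCauchyDevelopment) →
      ∀ 𝒟 : VacuumCauchyDevelopment D, 𝒟.IsMaximal →
        ∀ (O : Set 𝒟.carrier) (d : FinalStateDecomposition 𝒟.toSpacetime O 2),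
          (∀ i, Kerr.IsSubextremal (d.mass i) (d.spin i)) →
            O = Summit.FinalStateConjecture.exteriorOf 𝒟.toCauchyDevelopment d.charted →
              Summit.FinalStateConjecture.HasExhaustiveCharts d → SummitProperty X D :=
  fun X _ _ _ _ _ hI 𝒟 hmax O d hsub hO hex ↦ summitProperty_of_isMaximal X hI 𝒟 hmax O d hsub hO hex

end Summit.FinalStateConjecture.FinalStateConjecture.Theorems.OneLockedExplosion

end
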